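import Mathlib
import HarnessLib
import Summits.NavierStokesRegularity.NavierStokesRegularity.Theorems.ChiralWindowDoorDefs
import Summits.NavierStokesRegularity.NavierStokesRegularity.Theorems.ChiralWindowDoorLambda
import Summits.NavierStokesRegularity.NavierStokesRegularity.Theorems.ChiralWindowDoorEnergyLedger

/-!
# Door S20 «ChiralWindowDoor» — tools for the zoom crux K1: continuity of `Λ = (−Δ)^{1/2}` along a sequence of fields
# converging pointwise with uniform local `C²` control, uniform local bounds and `L²`-controlled far fields (3 zones)

Door S20 of nsreg-p1's local Type-I door family (`HOME/ns-regularity-ideate-p1/r19/R19-LINE.md`; DESIGN-ONLY, route NOT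
born).  K1 `LocalPointZoomChiralWindow` passes the NON-LOCAL chirality functional `curl − Λ` to the limit along the
parabolic point zoom.  The zoomed slices `Z_j` converge to the profile slice only pointwise / locally uniformly, are
uniformly bounded only on balls of radius `ρ/μ_j → ∞` (the local Type-I region), and beyond are controlled only in `L²`
(the Leray–Hopf energy, which is supercritical: `‖Z_j‖₂² ∼ μ_j⁻¹`).  This file proves the pure-analysis lemmas of the
three-zone argument:

* `norm_secondDiff_le_of_ball` — local second-difference bound from a `C²` bound on a ball;
* `setIntegral_lamK_compl_ball_le`, `setIntegral_lamK_sq_compl_ball_le` — tails `∫_{‖z‖≥L} lamK ≤ c₁/L`,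
  `∫_{‖z‖≥L} lamK² ≤ c₁π⁻²/L⁵`;
* `integral_tail_shift_le` — far field by AM–GM (`ab ≤ (ta² + t⁻¹b²)/2`, inlined): for `‖f‖ ≤ B` on `B_P(0)` and `f ∈ L²`,
  `∫_{‖z‖≥L₀} lamK(z)‖f(y+z)‖ ≤ B c₁/L₀ + ½(c₁π⁻² L⁻² + L⁻³ ∫‖f‖²)`, `L = P − ‖y‖`;
(The convergence lemma `Λ f_j(y) → Λ g(y)` built on these is `…ChiralWindowDoorZoomLambdaLimit.tendsto_fracLapHalf_of_zones`.)

Seat nsreg-p6 g12 (THEOREMS-ONLY door sequels, DIRECTOR-NS g8 #32 (2)/#36).  WHAT THIS IS NOT: not NS regularity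
(Clay A); not K1 — analysis tools; no route is opened.
-/

noncomputable section

-- the summit and its single sub-problem share the name (CONVENTIONS §1), as in every Theorems file
set_option linter.dupNamespace false

namespace Summit.NavierStokesRegularity.NavierStokesRegularity.Theorems.ChiralWindowDoorZoomLambdaTools

open MeasureTheory Set Filter Topology Metric Function
open scoped RealInnerProductSpace
open Summit.NavierStokesRegularity.NavierStokesRegularity.Theorems.ChiralWindowDoorDefs
open Summit.NavierStokesRegularity.NavierStokesRegularity.Theorems.ChiralWindowDoorLambda (lamK_mul_sq_le)
open Summit.NavierStokesRegularity.NavierStokesRegularity.Theorems.ChiralWindowDoorEnergyLedger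
  (integrable_inv_norm_add_pow_four integral_inv_norm_add_pow_four_le)

/-! ### Local second-difference bound -/

/-- **Local second-difference bound**: for `f` differentiable everywhere, with `Df` differentiable on the ball
`B_r(x)` and `‖D(Df)‖ ≤ M₂` there, `‖2f(x) − f(x+z) − f(x−z)‖ ≤ 2M₂‖z‖²` for `‖z‖ < r`. -/
theorem norm_secondDiff_le_of_ball {E F : Type*} [NormedAddCommGroup E] [NormedSpace ℝ E] [NormedAddCommGroup F]
    [NormedSpace ℝ F] {f : E → F} {M₂ r : ℝ} {x : E} (hd : Differentiable ℝ f)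
    (hd2 : ∀ y ∈ ball x r, DifferentiableAt ℝ (fderiv ℝ f) y)
    (hM : ∀ y ∈ ball x r, ‖fderiv ℝ (fderiv ℝ f) y‖ ≤ M₂) (hM₂ : 0 ≤ M₂) {z : E} (hz : ‖z‖ < r) :
    ‖(2 : ℝ) • f x - f (x + z) - f (x - z)‖ ≤ 2 * M₂ * ‖z‖ ^ 2 := by
  -- Step 1: the derivative is `M₂`-Lipschitz on the ball.
  have hLip : ∀ a ∈ ball x r, ∀ b ∈ ball x r, ‖fderiv ℝ f b - fderiv ℝ f a‖ ≤ M₂ * ‖b - a‖ := fun a ha b hb =>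
    Convex.norm_image_sub_le_of_norm_fderiv_le (fun y hy => hd2 y hy) (fun y hy => hM y hy) (convex_ball x r) ha hb
  -- Step 2: the second difference `h(w) = 2f(x) − f(x+w) − f(x−w)` has derivative `Df(x−w) − Df(x+w)`.
  set h : E → F := fun w => (2 : ℝ) • f x - f (x + w) - f (x - w) with hh
  have hder : ∀ w, HasFDerivAt h (fderiv ℝ f (x - w) - fderiv ℝ f (x + w)) w := by
    intro w
    have h1 : HasFDerivAt (fun w => f (x + w)) (fderiv ℝ f (x + w)) w := by
      have := (hd (x + w)).hasFDerivAt.comp w ((hasFDerivAt_id w).const_add x)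
      simpa [Function.comp_def] using this
    have h2 : HasFDerivAt (fun w => f (x - w)) (-fderiv ℝ f (x - w)) w := by
      have := (hd (x - w)).hasFDerivAt.comp w ((hasFDerivAt_id w).const_sub x)
      simpa [Function.comp_def] using this
    have h3 : HasFDerivAt h (0 - fderiv ℝ f (x + w) - -fderiv ℝ f (x - w)) w :=
      ((hasFDerivAt_const ((2 : ℝ) • f x) w).sub h1).sub h2
    exact h3.congr_fderiv (by abel)
  have hdiff : ∀ w, DifferentiableAt ℝ h w := fun w => (hder w).differentiableAt
  have hbound : ∀ w ∈ closedBall (0 : E) ‖z‖, ‖fderiv ℝ h w‖ ≤ 2 * M₂ * ‖z‖ := by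
    intro w hw
    rw [(hder w).fderiv]
    have hw' : ‖w‖ ≤ ‖z‖ := by simpa [mem_closedBall, dist_zero_right] using hw
    have hxw1 : x + w ∈ ball x r := by
      rw [mem_ball, dist_eq_norm, add_sub_cancel_left]; exact lt_of_le_of_lt hw' hz
    have hxw2 : x - w ∈ ball x r := by
      rw [mem_ball, dist_eq_norm, sub_sub_cancel_left, norm_neg]; exact lt_of_le_of_lt hw' hz
    calc ‖fderiv ℝ f (x - w) - fderiv ℝ f (x + w)‖ ≤ M₂ * ‖(x - w) - (x + w)‖ := hLip _ hxw1 _ hxw2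
      _ = M₂ * (2 * ‖w‖) := by
          rw [show x - w - (x + w) = -((2 : ℝ) • w) by simp [two_smul]; abel, norm_neg, norm_smul,
            Real.norm_eq_abs, abs_of_pos (by norm_num : (0 : ℝ) < 2)]
      _ ≤ M₂ * (2 * ‖z‖) := by gcongr
      _ = 2 * M₂ * ‖z‖ := by ring
  have hmv := Convex.norm_image_sub_le_of_norm_fderiv_le (fun w _ => hdiff w) hbound
    (convex_closedBall (0 : E) ‖z‖) (mem_closedBall_self (norm_nonneg z))
    (by simp [mem_closedBall, dist_zero_right] : z ∈ closedBall (0 : E) ‖z‖)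
  have h0 : h 0 = 0 := by simp [hh, two_smul]
  rw [h0, sub_zero, sub_zero] at hmv
  calc ‖(2 : ℝ) • f x - f (x + z) - f (x - z)‖ = ‖h z‖ := rfl
    _ ≤ 2 * M₂ * ‖z‖ * ‖z‖ := hmv
    _ = 2 * M₂ * ‖z‖ ^ 2 := by ring

/-! ### Tails of the kernel -/

/-- On `‖z‖ ≥ L > 0`: `lamK z ≤ 16π⁻² ((‖z‖ + L)⁴)⁻¹` (since `‖z‖ + L ≤ 2‖z‖`). -/
theorem lamK_le_of_le_norm {L : ℝ} (hL : 0 < L) {z : EuclideanSpace ℝ (Fin 3)} (hz : L ≤ ‖z‖) :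
    lamK z ≤ 16 / Real.pi ^ 2 * ((‖z‖ + L) ^ 4)⁻¹ := by
  have hz0 : 0 < ‖z‖ := hL.trans_le hz
  have h4 : (‖z‖ + L) ^ 4 ≤ 16 * ‖z‖ ^ 4 := by
    calc (‖z‖ + L) ^ 4 ≤ (2 * ‖z‖) ^ 4 :=
          pow_le_pow_left₀ (by positivity) (by linarith : ‖z‖ + L ≤ 2 * ‖z‖) 4
      _ = 16 * ‖z‖ ^ 4 := by ring
  unfold lamK
  calc 1 / Real.pi ^ 2 * (‖z‖ ^ 4)⁻¹ = 16 / Real.pi ^ 2 * (16 * ‖z‖ ^ 4)⁻¹ := by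
        field_simp
    _ ≤ 16 / Real.pi ^ 2 * ((‖z‖ + L) ^ 4)⁻¹ := by
        gcongr

/-- The volume constant `c₁ = 64|B₁|/π²` of the tail bounds. -/
theorem setIntegral_lamK_compl_ball_le {L : ℝ} (hL : 0 < L) :
    IntegrableOn lamK (ball (0 : EuclideanSpace ℝ (Fin 3)) L)ᶜ ∧
      ∫ z in (ball (0 : EuclideanSpace ℝ (Fin 3)) L)ᶜ, lamK z ≤
        64 * (volume : Measure (EuclideanSpace ℝ (Fin 3))).real (ball 0 1) / Real.pi ^ 2 / L := by
  set g : EuclideanSpace ℝ (Fin 3) → ℝ := fun z => 16 / Real.pi ^ 2 * ((‖z‖ + L) ^ 4)⁻¹ with hg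
  have hgi : Integrable g := (integrable_inv_norm_add_pow_four hL).const_mul _
  have hdom : ∀ z ∈ (ball (0 : EuclideanSpace ℝ (Fin 3)) L)ᶜ, ‖lamK z‖ ≤ g z := fun z hz => by
    rw [Real.norm_eq_abs, abs_of_nonneg (lamK_nonneg z)]
    exact lamK_le_of_le_norm hL (by simpa [mem_ball, dist_zero_right] using hz)
  have hint : IntegrableOn lamK (ball (0 : EuclideanSpace ℝ (Fin 3)) L)ᶜ :=
    Integrable.mono' hgi.integrableOn measurable_lamK.aestronglyMeasurable.restrict
      ((ae_restrict_iff' measurableSet_ball.compl).2 (ae_of_all _ hdom))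
  refine ⟨hint, ?_⟩
  calc ∫ z in (ball (0 : EuclideanSpace ℝ (Fin 3)) L)ᶜ, lamK z
      ≤ ∫ z in (ball (0 : EuclideanSpace ℝ (Fin 3)) L)ᶜ, g z :=
        setIntegral_mono_on hint hgi.integrableOn measurableSet_ball.compl fun z hz =>
          (le_abs_self _).trans ((Real.norm_eq_abs _).symm.le.trans (hdom z hz))
    _ ≤ ∫ z, g z := setIntegral_le_integral hgi (ae_of_all _ fun z => by rw [hg]; positivity)
    _ = 16 / Real.pi ^ 2 * ∫ z : EuclideanSpace ℝ (Fin 3), ((‖z‖ + L) ^ 4)⁻¹ := integral_const_mul _ _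
    _ ≤ 16 / Real.pi ^ 2 * (4 * (volume : Measure (EuclideanSpace ℝ (Fin 3))).real (ball 0 1) / L) := by
        gcongr; exact integral_inv_norm_add_pow_four_le hL
    _ = 64 * (volume : Measure (EuclideanSpace ℝ (Fin 3))).real (ball 0 1) / Real.pi ^ 2 / L := by ring

/-- On `‖z‖ ≥ L > 0`: `lamK z ^ 2 ≤ π⁻² L⁻⁴ · lamK z`. -/
theorem lamK_sq_le_of_le_norm {L : ℝ} (hL : 0 < L) {z : EuclideanSpace ℝ (Fin 3)} (hz : L ≤ ‖z‖) :
    lamK z ^ 2 ≤ 1 / Real.pi ^ 2 * (L ^ 4)⁻¹ * lamK z := by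
  rw [sq]
  refine mul_le_mul_of_nonneg_right ?_ (lamK_nonneg z)
  unfold lamK
  refine mul_le_mul_of_nonneg_left ?_ (by positivity)
  exact inv_anti₀ (by positivity) (pow_le_pow_left₀ hL.le hz 4)

/-- `∫_{‖z‖≥L} lamK² ≤ c₁ π⁻² / L⁵`. -/
theorem setIntegral_lamK_sq_compl_ball_le {L : ℝ} (hL : 0 < L) :
    IntegrableOn (fun z => lamK z ^ 2) (ball (0 : EuclideanSpace ℝ (Fin 3)) L)ᶜ ∧
      ∫ z in (ball (0 : EuclideanSpace ℝ (Fin 3)) L)ᶜ, lamK z ^ 2 ≤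
        1 / Real.pi ^ 2 * (L ^ 4)⁻¹ * (64 * (volume : Measure (EuclideanSpace ℝ (Fin 3))).real (ball 0 1) / Real.pi ^ 2 / L) := by
  obtain ⟨hint, hval⟩ := setIntegral_lamK_compl_ball_le hL
  have hdomi : IntegrableOn (fun z => 1 / Real.pi ^ 2 * (L ^ 4)⁻¹ * lamK z) (ball (0 : EuclideanSpace ℝ (Fin 3)) L)ᶜ :=
    hint.const_mul _
  have hmeas : AEStronglyMeasurable (fun z => lamK z ^ 2) (volume.restrict (ball (0 : EuclideanSpace ℝ (Fin 3)) L)ᶜ) :=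
    (measurable_lamK.pow_const 2).aestronglyMeasurable
  have hdom : ∀ z ∈ (ball (0 : EuclideanSpace ℝ (Fin 3)) L)ᶜ, ‖lamK z ^ 2‖ ≤ 1 / Real.pi ^ 2 * (L ^ 4)⁻¹ * lamK z :=
    fun z hz => by
      rw [Real.norm_eq_abs, abs_of_nonneg (sq_nonneg _)]
      exact lamK_sq_le_of_le_norm hL (by simpa [mem_ball, dist_zero_right] using hz)
  have hint2 : IntegrableOn (fun z => lamK z ^ 2) (ball (0 : EuclideanSpace ℝ (Fin 3)) L)ᶜ :=
    Integrable.mono' hdomi hmeas ((ae_restrict_iff' measurableSet_ball.compl).2 (ae_of_all _ hdom))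
  refine ⟨hint2, ?_⟩
  calc ∫ z in (ball (0 : EuclideanSpace ℝ (Fin 3)) L)ᶜ, lamK z ^ 2
      ≤ ∫ z in (ball (0 : EuclideanSpace ℝ (Fin 3)) L)ᶜ, 1 / Real.pi ^ 2 * (L ^ 4)⁻¹ * lamK z :=
        setIntegral_mono_on hint2 hdomi measurableSet_ball.compl fun z hz =>
          (le_abs_self _).trans ((Real.norm_eq_abs _).symm.le.trans (hdom z hz))
    _ = 1 / Real.pi ^ 2 * (L ^ 4)⁻¹ * ∫ z in (ball (0 : EuclideanSpace ℝ (Fin 3)) L)ᶜ, lamK z := integral_const_mul _ _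
    _ ≤ _ := by gcongr

/-- **Packaged kernel tails**: one constant `c > 0` with `∫_{‖z‖≥L} lamK ≤ c/L` and `∫_{‖z‖≥L} lamK² ≤ c/L⁵` for all
`L > 0` (with the integrability of both tails). -/
theorem exists_lamK_tail_const : ∃ c : ℝ, 0 < c ∧ ∀ L : ℝ, 0 < L →
    (IntegrableOn lamK (ball (0 : EuclideanSpace ℝ (Fin 3)) L)ᶜ ∧
      ∫ z in (ball (0 : EuclideanSpace ℝ (Fin 3)) L)ᶜ, lamK z ≤ c / L) ∧
    (IntegrableOn (fun z => lamK z ^ 2) (ball (0 : EuclideanSpace ℝ (Fin 3)) L)ᶜ ∧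
      ∫ z in (ball (0 : EuclideanSpace ℝ (Fin 3)) L)ᶜ, lamK z ^ 2 ≤ c / L ^ 5) := by
  set V : ℝ := (volume : Measure (EuclideanSpace ℝ (Fin 3))).real (ball 0 1) with hV
  have hVpos : 0 < V := by
    rw [hV, measureReal_def]
    exact ENNReal.toReal_pos (measure_ball_pos volume (0 : EuclideanSpace ℝ (Fin 3)) one_pos).ne'
      measure_ball_lt_top.ne
  have hπ : 1 ≤ Real.pi ^ 2 := by nlinarith [Real.pi_gt_three]
  refine ⟨64 * V / Real.pi ^ 2 + 1, by positivity, fun L hL => ⟨?_, ?_⟩⟩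
  · obtain ⟨hi, hv⟩ := setIntegral_lamK_compl_ball_le hL
    refine ⟨hi, hv.trans ?_⟩
    exact div_le_div_of_nonneg_right (by linarith) hL.le
  · obtain ⟨hi, hv⟩ := setIntegral_lamK_sq_compl_ball_le hL
    refine ⟨hi, hv.trans ?_⟩
    have hL5 : 0 < L ^ 5 := by positivity
    rw [show 1 / Real.pi ^ 2 * (L ^ 4)⁻¹ * (64 * V / Real.pi ^ 2 / L) = (64 * V / Real.pi ^ 2 / Real.pi ^ 2) / L ^ 5 by
      field_simp]
    have h1 : 64 * V / Real.pi ^ 2 / Real.pi ^ 2 ≤ 64 * V / Real.pi ^ 2 := div_le_self (by positivity) hπ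
    exact div_le_div_of_nonneg_right (by linarith) hL5.le

/-! ### The far field by AM–GM -/

/-- **Far-field tail by AM–GM.**  Let `f` be a.e.-strongly measurable with `‖f w‖ ≤ B` on the ball `‖w‖ < P`, and
`‖f‖²` integrable with `∫‖f‖² ≤ E`.  For `‖y‖ < P`, `L = P − ‖y‖`, and `L₀ > 0`, with the tail constant `c` of
`exists_lamK_tail_const`:
`∫_{‖z‖≥L₀} lamK(z)‖f(y+z)‖ dz ≤ B c/L₀ + ½ (L³ · c/L⁵ + L⁻³ E)` (and the integrand is integrable there). -/
theorem integral_tail_shift_le {c : ℝ} (hc : ∀ L : ℝ, 0 < L →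
      (IntegrableOn lamK (ball (0 : EuclideanSpace ℝ (Fin 3)) L)ᶜ ∧
        ∫ z in (ball (0 : EuclideanSpace ℝ (Fin 3)) L)ᶜ, lamK z ≤ c / L) ∧
      (IntegrableOn (fun z => lamK z ^ 2) (ball (0 : EuclideanSpace ℝ (Fin 3)) L)ᶜ ∧
        ∫ z in (ball (0 : EuclideanSpace ℝ (Fin 3)) L)ᶜ, lamK z ^ 2 ≤ c / L ^ 5))
    {f : EuclideanSpace ℝ (Fin 3) → EuclideanSpace ℝ (Fin 3)} (hfm : AEStronglyMeasurable f volume)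
    {B P E : ℝ} (hB : 0 ≤ B) (hfB : ∀ w, ‖w‖ < P → ‖f w‖ ≤ B) (hf2 : Integrable (fun w => ‖f w‖ ^ 2))
    (hE : ∫ w, ‖f w‖ ^ 2 ≤ E) {y : EuclideanSpace ℝ (Fin 3)} (hy : ‖y‖ < P) {L₀ : ℝ} (hL₀ : 0 < L₀) :
    IntegrableOn (fun z => lamK z * ‖f (y + z)‖) (ball (0 : EuclideanSpace ℝ (Fin 3)) L₀)ᶜ ∧
      ∫ z in (ball (0 : EuclideanSpace ℝ (Fin 3)) L₀)ᶜ, lamK z * ‖f (y + z)‖ ≤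
        B * (c / L₀) + ((P - ‖y‖) ^ 3 * (c / (P - ‖y‖) ^ 5) + ((P - ‖y‖) ^ 3)⁻¹ * E) / 2 := by
  set L : ℝ := P - ‖y‖ with hL
  have hLpos : 0 < L := by rw [hL]; linarith
  obtain ⟨⟨hki, hkv⟩, -⟩ := hc L₀ hL₀
  obtain ⟨-, ⟨hk2i, hk2v⟩⟩ := hc L hLpos
  -- the shifted square is integrable with the same integral
  have hf2s : Integrable (fun z : EuclideanSpace ℝ (Fin 3) => ‖f (y + z)‖ ^ 2) :=
    hf2.comp_add_left y
  have hf2sv : ∫ z : EuclideanSpace ℝ (Fin 3), ‖f (y + z)‖ ^ 2 = ∫ w, ‖f w‖ ^ 2 :=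
    integral_add_left_eq_self (fun w => ‖f w‖ ^ 2) y
  -- the majorant
  set m : EuclideanSpace ℝ (Fin 3) → ℝ := fun z => B * lamK z +
    (ball (0 : EuclideanSpace ℝ (Fin 3)) L)ᶜ.indicator (fun z => (L ^ 3 * lamK z ^ 2 + (L ^ 3)⁻¹ * ‖f (y + z)‖ ^ 2) / 2) z
    with hm
  have hind_int : Integrable ((ball (0 : EuclideanSpace ℝ (Fin 3)) L)ᶜ.indicator
      (fun z => (L ^ 3 * lamK z ^ 2 + (L ^ 3)⁻¹ * ‖f (y + z)‖ ^ 2) / 2)) := by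
    refine IntegrableOn.integrable_indicator ?_ measurableSet_ball.compl
    exact ((hk2i.const_mul (L ^ 3)).add (hf2s.integrableOn.const_mul _)).div_const 2
  have hmi : IntegrableOn m (ball (0 : EuclideanSpace ℝ (Fin 3)) L₀)ᶜ :=
    (hki.const_mul B).add hind_int.integrableOn
  -- measurability of the integrand
  have hgm : AEStronglyMeasurable (fun z => lamK z * ‖f (y + z)‖)
      (volume.restrict (ball (0 : EuclideanSpace ℝ (Fin 3)) L₀)ᶜ) := by
    have h1 : AEStronglyMeasurable (fun z : EuclideanSpace ℝ (Fin 3) => f (y + z)) volume := by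
      have hmp : MeasurePreserving (fun z : EuclideanSpace ℝ (Fin 3) => y + z) volume volume :=
        measurePreserving_add_left volume y
      exact hfm.comp_measurePreserving hmp
    exact (measurable_lamK.aestronglyMeasurable.mul h1.norm).restrict
  -- pointwise domination on the tail region
  have hdom : ∀ z ∈ (ball (0 : EuclideanSpace ℝ (Fin 3)) L₀)ᶜ, ‖lamK z * ‖f (y + z)‖‖ ≤ m z := by
    intro z _
    rw [Real.norm_eq_abs, abs_of_nonneg (mul_nonneg (lamK_nonneg z) (norm_nonneg _)), hm]
    by_cases hyz : ‖y + z‖ < P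
    · have h1 : lamK z * ‖f (y + z)‖ ≤ B * lamK z := by
        rw [mul_comm]; exact mul_le_mul_of_nonneg_right (hfB _ hyz) (lamK_nonneg z)
      have h2 : 0 ≤ (ball (0 : EuclideanSpace ℝ (Fin 3)) L)ᶜ.indicator
          (fun z => (L ^ 3 * lamK z ^ 2 + (L ^ 3)⁻¹ * ‖f (y + z)‖ ^ 2) / 2) z := by
        refine indicator_nonneg (fun w _ => ?_) z
        positivity
      simp only
      linarith
    · have hzL : z ∈ (ball (0 : EuclideanSpace ℝ (Fin 3)) L)ᶜ := by
        rw [mem_compl_iff, mem_ball, dist_zero_right, not_lt, hL]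
        have : P ≤ ‖y + z‖ := not_lt.1 hyz
        linarith [norm_add_le y z]
      simp only
      rw [indicator_of_mem hzL]
      have h3 : lamK z * ‖f (y + z)‖ ≤ (L ^ 3 * lamK z ^ 2 + (L ^ 3)⁻¹ * ‖f (y + z)‖ ^ 2) / 2 := by
        -- AM–GM with the weight `t = L³`: `ab ≤ (t a² + t⁻¹ b²)/2`
        have hL3 : 0 < L ^ 3 := by positivity
        have e : (L ^ 3 * lamK z ^ 2 + (L ^ 3)⁻¹ * ‖f (y + z)‖ ^ 2) / 2 - lamK z * ‖f (y + z)‖ =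
            (L ^ 3 * lamK z - ‖f (y + z)‖) ^ 2 / (2 * L ^ 3) := by
          field_simp
          ring
        have h : 0 ≤ (L ^ 3 * lamK z - ‖f (y + z)‖) ^ 2 / (2 * L ^ 3) := by positivity
        linarith
      have h4 : 0 ≤ B * lamK z := mul_nonneg hB (lamK_nonneg z)
      linarith
  have hint : IntegrableOn (fun z => lamK z * ‖f (y + z)‖) (ball (0 : EuclideanSpace ℝ (Fin 3)) L₀)ᶜ :=
    Integrable.mono' hmi hgm ((ae_restrict_iff' measurableSet_ball.compl).2 (ae_of_all _ hdom))
  refine ⟨hint, ?_⟩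
  calc ∫ z in (ball (0 : EuclideanSpace ℝ (Fin 3)) L₀)ᶜ, lamK z * ‖f (y + z)‖
      ≤ ∫ z in (ball (0 : EuclideanSpace ℝ (Fin 3)) L₀)ᶜ, m z :=
        setIntegral_mono_on hint hmi measurableSet_ball.compl fun z hz =>
          (le_abs_self _).trans ((Real.norm_eq_abs _).symm.le.trans (hdom z hz))
    _ = B * (∫ z in (ball (0 : EuclideanSpace ℝ (Fin 3)) L₀)ᶜ, lamK z) +
          ∫ z in (ball (0 : EuclideanSpace ℝ (Fin 3)) L₀)ᶜ, (ball (0 : EuclideanSpace ℝ (Fin 3)) L)ᶜ.indicator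
            (fun z => (L ^ 3 * lamK z ^ 2 + (L ^ 3)⁻¹ * ‖f (y + z)‖ ^ 2) / 2) z := by
        rw [hm, integral_add (hki.const_mul B) hind_int.integrableOn, integral_const_mul]
    _ ≤ B * (c / L₀) + ∫ z, (ball (0 : EuclideanSpace ℝ (Fin 3)) L)ᶜ.indicator
            (fun z => (L ^ 3 * lamK z ^ 2 + (L ^ 3)⁻¹ * ‖f (y + z)‖ ^ 2) / 2) z :=
        add_le_add (mul_le_mul_of_nonneg_left hkv hB)
          (setIntegral_le_integral hind_int (ae_of_all _ fun z => indicator_nonneg (fun w _ => by positivity) z))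
    _ = B * (c / L₀) + (L ^ 3 * (∫ z in (ball (0 : EuclideanSpace ℝ (Fin 3)) L)ᶜ, lamK z ^ 2) +
          (L ^ 3)⁻¹ * ∫ z in (ball (0 : EuclideanSpace ℝ (Fin 3)) L)ᶜ, ‖f (y + z)‖ ^ 2) / 2 := by
        rw [integral_indicator measurableSet_ball.compl, integral_div,
          integral_add (hk2i.const_mul _) (hf2s.integrableOn.const_mul _), integral_const_mul, integral_const_mul]
    _ ≤ B * (c / L₀) + (L ^ 3 * (c / L ^ 5) + (L ^ 3)⁻¹ * E) / 2 := by
        have hE' : ∫ z in (ball (0 : EuclideanSpace ℝ (Fin 3)) L)ᶜ, ‖f (y + z)‖ ^ 2 ≤ E :=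
          calc ∫ z in (ball (0 : EuclideanSpace ℝ (Fin 3)) L)ᶜ, ‖f (y + z)‖ ^ 2
              ≤ ∫ z, ‖f (y + z)‖ ^ 2 := setIntegral_le_integral hf2s (ae_of_all _ fun z => by positivity)
            _ = ∫ w, ‖f w‖ ^ 2 := hf2sv
            _ ≤ E := hE
        have hL3 : 0 ≤ L ^ 3 := by positivity
        have hL3' : 0 ≤ (L ^ 3)⁻¹ := by positivity
        have h := add_le_add (mul_le_mul_of_nonneg_left hk2v hL3) (mul_le_mul_of_nonneg_left hE' hL3')
        linarith

end Summit.NavierStokesRegularity.NavierStokesRegularity.Theorems.ChiralWindowDoorZoomLambdaTools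

end
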